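import Mathlib
import HarnessLib
import HarnessLib.Audit

/-!
# Kadiri: at most one exceptional zero of the Dirichlet `L`-functions modulo `q` in an explicit
# region, and it is real and belongs to a real non-principal character

Topic: `Literature/NumberTheory/LFunctions`. A NAMED FACT (D-0014), not proved here; users take
`(h : Literature.NumberTheory.LFunctions.Kadiri2018.dirichlet_atMostOneZero)`.

Vendored while grounding route item `stmt-QuantumAdvantage-14545`
(`Summit.QuantumAdvantage.QuantumAdvantage.Theses.ThirdFactorialPincer.SexticEscapeCount`): its
paper proof needs "the Thorner–Zaman exceptional character of `F_p = K_p(ω)` is NOT trivial", i.e.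
that `ζ_{F_p} = ζ·L(ψ₃)·|L(χ_p)|²·|L(χ_pψ₃)|²` has no real zero close to `1` — which is exactly the
statement that an exceptional zero near `1` can only come from a REAL non-principal character
(here the only real one is `χ₋₃`, and `L(σ, χ₋₃) > 0` on `(0,1)`). Nothing of this kind was in the
tree (the Dirichlet zero-free facts present are `Khale2024_zeroFreeRegion`, `|t| ≥ 10` only, and the
Vinogradov–Korobov regions).

## What the source prints

H. Kadiri, *An explicit zero-free region for the Dirichlet L-functions*, arXiv:math/0510570, §1
(text read 2026-08-16, p.3 of the materialised copy): "Let `𝓛_q(s)` be the product of the `φ(q)`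
Dirichlet `L`-functions modulo `q`. … **Theorem 1.1.** The function `𝓛_q(s)` has, at most, one
single zero in the region `σ ≥ 1 − 1/(R₀ log(max(q, q|t|)))` where `R₀ = 6.3970`. Such a zero, if
it exists, is real, simple and corresponds to a real non-principal character modulo `q`. We shall
refer to it as an exceptional zero and `q` as an exceptional modulus." This preprint is
UNREFEREED; Kadiri's Lille thesis (2002) has the same all-`q` statement with `R₀ = 6.4355`.
ERRATUM (2026-08-26, ls-lit-r3 g2 — the earlier text here said the published version "states the
same theorem with `R₀ = 6.4355`"; that is NOT what it prints): the REFEREED paper H. Kadiri,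
*Explicit zero-free regions for Dirichlet L-functions*, Mathematika 64 (2018) 445–474
[cite: Kadiri2018, Thm 1.1] is a SMALL-MODULUS theorem — zbMATH review Zbl 1412.11096 (read
2026-08-26 via api.zbmath.org): "for every non-principle primitive Dirichlet character `χ` modulo
`q` with `3 ≤ q ≤ 400 000`, the Dirichlet `L`-function `L(s,χ)` has no zeros in the region
`Re(s) ≥ 1 − 1/(R log(q max(1,|Im(s)|)))` with `R = 5.60`. This improves the previous result
(`R = 6.436`) of the author from her PhD thesis [Lille 2001] and the result (`R = 9.646`) due to
K. S. McCurley"; the same reading in Lu–Zaman–Zhao, Math. Comp. (2026) = arXiv:2602.03626 p. 1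
("cf. Kadiri [Kad18] for improvements when `q ⩽ 4×10⁵`"), Bordignon, JNT 201 (2019) =
arXiv:1809.05226 p. 3, and Bennett–Martin–O'Bryant–Rechnitzer, Illinois J. Math. 62 (2018)
Prop. 4.34. The all-`q` at-most-one-zero theorem OF REFEREED RECORD is McCurley, J. Number Theory
19 (1984) 7–32, Theorem 1 (`R = 9.645908801`, floor `max(q, q|t|, 10)`, OPEN region), typed as
`Literature.NumberTheory.LFunctions.McCurley1984_theorem1` (`ZeroFreeRegionUpTo.lean`), and
`Kadiri2018.dirichlet_atMostOneZero_of_mccurley` (ibid.) DERIVES the `∃`-form fact below from it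
(witness `R₀' = 1 + R + R log 10`). So the fact below is implied by refereed print for all `q ≥ 3`;
only its attribution needed correcting.

## Lean rendering / design choices

* To be implied by EVERY printed version (arXiv `6.3970`, thesis `6.4355`, McCurley `9.6459…`
  with floor `10`) the constant is EXISTENTIAL, `∃ R₀ ≥ 1` — all the grounded route needs (its own constants are
  absolute and inexplicit). The bound `1 ≤ R₀` together with `3 ≤ q` keeps
  `R₀ · log(max(q, q|t|)) ≥ log 3 > 1`, so the region never degenerates (no division junk).
* "Dirichlet `L`-functions modulo `q`": ALL `χ : DirichletCharacter ℂ q` (principal and imprimitive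
  included, as in the source's `𝓛_q`), `L(s,χ) = DirichletCharacter.LFunction χ s` (Mathlib, entire
  continuation). We exclude `s = 1` explicitly: the principal `L`-function has a POLE there and
  Mathlib assigns a junk finite value to `LFunction 1 1`; genuine zeros are never at `s = 1`
  (`L(1,χ) ≠ 0` for `χ ≠ 1`), so this loses nothing printed.
* "at most one zero of the product" is rendered on pairs `(χ, s)`: two zeros in the region coincide
  as pairs. Simplicity of the zero is NOT rendered (weaker than print, deliberately).
* "real" = `s.im = 0`; "real non-principal character" = `χ ≠ 1 ∧ χ ^ 2 = 1`.
-/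

namespace Literature.NumberTheory.LFunctions.Kadiri2018

/-- The explicit region of Kadiri's Theorem 1.1 with constant `R₀`:
`σ ≥ 1 − 1/(R₀ · log(max(q, q·|t|)))` for `s = σ + it`. [cite: Kadiri2018, Thm 1.1] -/
def InRegion (R₀ : ℝ) (q : ℕ) (s : ℂ) : Prop :=
  1 - 1 / (R₀ * Real.log (max (q : ℝ) ((q : ℝ) * |s.im|))) ≤ s.re

/-- **Kadiri, Theorem 1.1 (∃-constant form): at most one exceptional zero modulo `q`, real, from a
real non-principal character.** There is an absolute `R₀ ≥ 1` (arXiv:math/0510570: `6.3970`;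
Lille thesis 2002: `6.4355`; refereed, all `q`: McCurley 1984 `9.645908801` with floor `10` — see
`Kadiri2018.dirichlet_atMostOneZero_of_mccurley`; the refereed Mathematika 2018 paper proves
`R = 5.60` for `3 ≤ q ≤ 4·10⁵` only) such that for every modulus `q ≥ 3`: if `χ₁, χ₂` are
Dirichlet characters mod `q` and `s₁, s₂ ≠ 1` lie in the region
`Re s ≥ 1 − 1/(R₀ log max(q, q|Im s|))` with `L(s₁, χ₁) = L(s₂, χ₂) = 0`, then `(χ₁, s₁) = (χ₂, s₂)`,
the zero is real (`Im s₁ = 0`) and `χ₁` is a real non-principal character (`χ₁ ≠ 1`, `χ₁² = 1`).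
Vendored while grounding `Summit.QuantumAdvantage.QuantumAdvantage.Theses.ThirdFactorialPincer.SexticEscapeCount`
(complex characters mod `p`, `3p` have no exceptional zero).
[cite: McCurley1984ZFR, Theorem 1] [cite: Kadiri2018, Thm 1.1] -/
def dirichlet_atMostOneZero : Prop :=
  ∃ R₀ : ℝ, 1 ≤ R₀ ∧ ∀ (q : ℕ) [NeZero q], 3 ≤ q →
    ∀ (χ₁ χ₂ : DirichletCharacter ℂ q) (s₁ s₂ : ℂ), s₁ ≠ 1 → s₂ ≠ 1 →
      InRegion R₀ q s₁ → InRegion R₀ q s₂ →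
      DirichletCharacter.LFunction χ₁ s₁ = 0 → DirichletCharacter.LFunction χ₂ s₂ = 0 →
      (χ₁ = χ₂ ∧ s₁ = s₂) ∧ s₁.im = 0 ∧ χ₁ ≠ 1 ∧ χ₁ ^ 2 = 1

/-- Sanity: the region is non-degenerate — for `R₀ ≥ 1` and `q ≥ 3` the denominator is `> 1`.
[folklore] -/
theorem one_lt_mul_log {R₀ : ℝ} (hR : 1 ≤ R₀) {q : ℕ} (hq : 3 ≤ q) (s : ℂ) :
    1 < R₀ * Real.log (max (q : ℝ) ((q : ℝ) * |s.im|)) := by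
  have hq3 : (3 : ℝ) ≤ (q : ℝ) := by exact_mod_cast hq
  have hlog3 : 1 < Real.log 3 := by
    have h := Real.exp_one_lt_d9
    rw [Real.lt_log_iff_exp_lt (by norm_num)]
    linarith
  have hle : Real.log 3 ≤ Real.log (max (q : ℝ) ((q : ℝ) * |s.im|)) :=
    Real.log_le_log (by norm_num) (le_trans hq3 (le_max_left _ _))
  have h1 : 1 < Real.log (max (q : ℝ) ((q : ℝ) * |s.im|)) := lt_of_lt_of_le hlog3 hle
  have h0 : 0 < Real.log (max (q : ℝ) ((q : ℝ) * |s.im|)) := lt_trans one_pos h1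
  calc (1 : ℝ) = 1 * 1 := by ring
    _ < R₀ * Real.log (max (q : ℝ) ((q : ℝ) * |s.im|)) :=
        mul_lt_mul' hR h1 zero_le_one (lt_of_lt_of_le one_pos hR)

/-- Consequence used by the grounded route: under the fact, a COMPLEX character (`χ² ≠ 1`) has no
zero `s ≠ 1` in the region. [cite: Kadiri2018, Thm 1.1] -/
theorem no_zero_of_sq_ne_one (h : dirichlet_atMostOneZero) :
    ∃ R₀ : ℝ, 1 ≤ R₀ ∧ ∀ (q : ℕ) [NeZero q], 3 ≤ q → ∀ (χ : DirichletCharacter ℂ q) (s : ℂ),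
      χ ^ 2 ≠ 1 → s ≠ 1 → InRegion R₀ q s → DirichletCharacter.LFunction χ s ≠ 0 := by
  obtain ⟨R₀, hR, H⟩ := h
  refine ⟨R₀, hR, fun q _ hq χ s hχ hs hreg hL => ?_⟩
  exact hχ (H q hq χ χ s s hs hs hreg hreg hL hL).2.2.2

end Literature.NumberTheory.LFunctions.Kadiri2018
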